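import Mathlib.Analysis.SpecialFunctions.Pow.Real
import Literature.NumberTheory.EllipticCurves.BhargavaHo2022.TwoMarkedPoints
import HarnessLib

/-!
# Bhargava–Ho 2022, Theorem 9.1: the number of curves of bounded height in a large subfamily of `F₂`
# (named fact), with the proved corollaries "a large subfamily has positive relative density in
# `F₂`" and "a 100 % property of `F₂` is a 100 % property of every large subfamily"

Topic `Literature/NumberTheory/EllipticCurves`, cluster `BhargavaHo2022`; companion of
`TwoMarkedPoints.lean` (the family `F₂`, its height, `CongruenceFamily₂`, `IsLarge`, `below`,
`proportionOn`, `HasDensityOn`, and the named fact `thm10_1_F2`). ONE named fact + proved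
corollaries; no definition, no instance. Consumer (cell bsd-rank2, D-0059 route
`route-BirchSwinnertonDyer-CountingDoorF2AtThree`, TWIN leaf `PAdicBSDRankTwoPositiveProportion`):
the support item `GenericMembersLargeF2` ("100 % of every large subfamily with nonempty local
conditions has trivial torsion and rank `≥ 2`") is Bhargava–Ho's Thm. 10.1 — printed, and vendored
as `thm10_1_F2`, for the WHOLE family `F₂` — transported to a large subfamily `Φ`; the transport is
exactly the positive relative density of `Φ` inside `F₂`, i.e. Thm. 9.1 below
(`hasDensityOn_torsionOrder_rank_of_isLarge`).

**Source** (held, `paper:arxiv-2207.03309`, LaTeX text; page = chunk): M. Bhargava, W. Ho, *On average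
sizes of Selmer groups and ranks in families of elliptic curves having marked points*,
arXiv:2207.03309 (2022) [BhargavaHo2022].
* §9.1, **Theorem 9.1** (p0031 L10–L13, verbatim): "Let `Φ` be any large subfamily of `F`. Then the
  number of elliptic curves `E` in `Φ` with `H(E) < X` is given by
  `∫_{H(a⃗)<X} da⃗ · ∏_p M_p(Φ) · X^{n/k} + o(X^{n/k})`." Here `F = F₂`, `n/k = 2/3` (four parameters
  `a₁, a₂, a₂', a₃` of weights `1, 2, 2, 3` against the weight-`12` height; cf. p0033 L71
  "`o(X^{2/3})`"), and the archimedean factor is the volume of the region `{H < 1} ⊆ ℝ⁴`.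
* §8.2 (p0026, the display after Prop. 8.1): "if `Φ` is a large subfamily of `F`, then we may define
  `M_p(Φ)` to be the measure of `Φ_p^inv` with respect to the measure `da⃗` on `ℤ_p^m` … normalized so
  that the total measure is `1`. That is, we have `M_p(Φ) = ∫_{E = E(a⃗) ∈ Φ_p} da⃗`", `Φ_p` being "the
  resulting family of curves defined by congruence conditions over `ℤ_p`" (§8.2, first sentence).
  For a `CongruenceFamily₂` (condition at `p`: the residue of `(a₁, a₂, a₂', a₃)` modulo `p ^ k_p`
  lies in `residues p`) this local density is `#(residues p) / p^{4 k_p}`; it is POSITIVE iff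
  `residues p` is nonempty, and for a large `Φ` it is `1 - O(p⁻²)` for `p ≥ p₀` (largeness: every
  member with `p² ∤ Δ` passes at `p`; Prop. 9.2, the uniformity estimate
  "`#{a⃗ ∈ F : H(a⃗) < X and p² ∣ Δ'(a⃗) for some p > Y} = O_ε(X^{n/k+ε}/Y) + o(X^{n/k})`", p0031
  L15–L20), so the Euler product converges to a positive number.
* §9.2, Theorem 9.6 (p0033 L128 – p0034 L3): the Selmer averages over a large `Φ` are computed by
  DIVIDING by `∫_{Φ_p} da⃗ = M_p(Φ)` at every `p` — Bhargava–Ho's "large subfamily" tacitly has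
  nonempty local conditions at every prime (an empty condition at one prime makes the family empty);
  the fact below carries this as the explicit hypothesis `∀ p, p.Prime → (Φ.residues p).Nonempty`.

## Contents

* named fact `thm9_1_F2`: for every large `Φ` with nonempty local conditions there is `c_Φ > 0` with
  `#{a ∈ Φ : H(a) < X} / X^{2/3} → c_Φ` — Thm. 9.1 with its main-term constant
  `c_Φ = Vol{H < 1} · ∏_p M_p(Φ)`, recorded through its one printed property used downstream,
  positivity (the explicit Euler product is not transcribed: -- TODO(general form): `c_Φ` as the
  product of the local densities `#(residues p)/p^{4 k_p}` and the volume `12` of `{H < 1}` for the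
  tree's integer height; and the families `F₀, F₁, F₁(2), F₁(3)`).
* PROVED corollaries (modulo the fact): `thm9_1_F2.relative` — a large `Φ` with nonempty local
  conditions has positive lower RELATIVE density in `F₂`: `δ · #(all.below X) ≤ #(Φ.below X)`
  eventually, some `δ > 0`; `CongruenceFamily₂.hasDensityOn_one_of_relative` (no fact; pure
  counting) — a property holding for 100 % of `F₂` holds for 100 % of any subfamily of positive lower
  relative density; `thm9_1_F2.hasDensityOn_one_of_all` — hence for 100 % of every large `Φ` with
  nonempty local conditions; `thm9_1_F2.hasDensityOn_torsionOrder_rank_of_isLarge` — with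
  `thm10_1_F2`: 100 % of every such `Φ` has trivial rational torsion and rank `≥ 2` (the printed
  content of the route's support item `GenericMembersLargeF2` minus its `ρ̄₃`-clause).

PARTITION: none — cell bsd-rank2, r_an ≥ 2, summit axis S0; TWIN (D-0056): n/a. B1 honesty: counting
statements about a family of curves ordered by height; nothing here mentions an `L`-function, a
Selmer group or the analytic rank.
-/

open Filter Topology

namespace Literature.NumberTheory.EllipticCurves.BhargavaHo2022

/-! ### Theorem 9.1 for `F₂` (named fact) -/

/-- **Bhargava–Ho 2022, Thm. 9.1 for `F = F₂`** (with §8.2 for the local densities). As printed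
(§9.1, p. 31): "Theorem 9.1. Let `Φ` be any large subfamily of `F`. Then the number of elliptic curves
`E` in `Φ` with `H(E) < X` is given by `∫_{H(a⃗)<X} da⃗ · ∏_p M_p(Φ) · X^{n/k} + o(X^{n/k})`," where
(§8.2, p. 26) "`M_p(Φ) = ∫_{E = E(a⃗) ∈ Φ_p} da⃗`" is the `p`-adic measure of the local condition
defining `Φ` at `p` (for a `CongruenceFamily₂`: `#(residues p) / p^{4·expt p}`), and `n/k = 2/3` for
`F₂`. Transcription over the tree's vocabulary (`CongruenceFamily₂`, `IsLarge`, `below`, the integer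
height `Params.height = H`): for every large `Φ` whose local condition is nonempty at every prime —
the standing assumption under which Bhargava–Ho use the theorem (Thm. 9.6 divides by `M_p(Φ)`), and
under which the main-term constant `c_Φ = Vol{H < 1} · ∏_p M_p(Φ)` is positive (each factor is
positive; the product converges by largeness and the uniformity estimate Prop. 9.2) — the counting
function satisfies `#(Φ.below X) / X^{2/3} → c_Φ` for some `c_Φ > 0`. Named fact (D-0014): nothing is
asserted; users take `(h : thm9_1_F2)`.
-- TODO(general form): the explicit constant `c_Φ = 12 · ∏_p #(Φ.residues p) / p^{4·Φ.expt p}`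
-- (`12 = Vol{H < 1}` for the integer height), and the four other families of the theorem.
[cite: BhargavaHo2022, Thm. 9.1 (§9.1, p. 31), with §8.2 eq. for M_p(Φ) (p. 26), Prop. 9.2 (p. 31) and Thm. 9.6 (pp. 33–34)] -/
def thm9_1_F2 : Prop :=
  ∀ Φ : CongruenceFamily₂, Φ.IsLarge → (∀ p : ℕ, p.Prime → (Φ.residues p).Nonempty) →
    ∃ c : ℝ, 0 < c ∧
      Tendsto (fun X : ℕ ↦ ((Φ.below X).card : ℝ) / (X : ℝ) ^ ((2 : ℝ) / 3)) atTop (𝓝 c)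

/-! ### Counting lemmas over the vocabulary (no fact) -/

namespace CongruenceFamily₂

variable (Φ : CongruenceFamily₂)

/-- The members of `Φ` of height `< X` are among the members of `F₂` of height `< X`.
[cite: BhargavaHo2022, §1 (subfamilies of F₂)] -/
theorem below_subset_all_below (X : ℕ) : Φ.below X ⊆ all.below X := by
  intro a ha
  rw [mem_below_iff] at ha ⊢
  exact ⟨(mem_all_iff a).mpr ha.1.1, ha.2⟩

/-- The whole family has a nonempty (trivial) local condition at every `p`.
[cite: BhargavaHo2022, §1 ("the sets of all curves … in F₂ are large")] -/
theorem residues_all_nonempty (p : ℕ) : (all.residues p).Nonempty :=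
  ⟨((0 : ZMod (p ^ 0)), (0 : ZMod (p ^ 0)), (0 : ZMod (p ^ 0)), (0 : ZMod (p ^ 0))), Set.mem_univ _⟩

/-- A proportion is the average of an indicator (aligning the decidability instances). [folklore] -/
private theorem proportionOn_eq_averageOn (P : Params → Prop) [DecidablePred P] (X : ℕ) :
    Φ.proportionOn P X = Φ.averageOn (fun a ↦ if P a then 1 else 0) X := by
  unfold CongruenceFamily₂.proportionOn
  congr 1
  funext a
  congr 1

/-- A proportion is `#{a ∈ Φ.below X | P a} / #(Φ.below X)`. [folklore] -/
private theorem proportionOn_eq_card_filter_div (P : Params → Prop) [DecidablePred P] (X : ℕ) :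
    Φ.proportionOn P X = (((Φ.below X).filter P).card : ℝ) / (Φ.below X).card := by
  rw [proportionOn_eq_averageOn Φ P X]
  show (∑ a ∈ Φ.below X, (if P a then (1 : ℝ) else 0)) / ((Φ.below X).card : ℝ) = _
  rw [Finset.sum_boole]

/-- A proportion is at most `1`. [folklore] -/
private theorem proportionOn_le_one (P : Params → Prop) (X : ℕ) : Φ.proportionOn P X ≤ 1 := by
  classical
  rw [proportionOn_eq_card_filter_div Φ P X]
  rcases Nat.eq_zero_or_pos (Φ.below X).card with h0 | hpos
  · rw [h0, Nat.cast_zero, div_zero]; exact zero_le_one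
  · rw [div_le_one (by exact_mod_cast hpos)]
    exact_mod_cast Finset.card_filter_le _ _

/-- **Transport of 100 % properties along positive relative density** (pure counting, no fact): if
`Φ` has positive lower relative density in `F₂` (`δ · #(all.below X) ≤ #(Φ.below X)` eventually,
`δ > 0`) and a property `P` holds for 100 % of `F₂` ordered by height, then `P` holds for 100 % of
`Φ`: the exceptions in `Φ.below X` are among the exceptions in `all.below X`, whose number is
`o(#(all.below X)) = o(#(Φ.below X))`. [cite: BhargavaHo2022, Thm. 9.1 (use: §10, proof of Thm. 10.1, "100%" statements over subfamilies)] -/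
theorem hasDensityOn_one_of_relative {P : Params → Prop}
    (hrel : ∃ δ : ℝ, 0 < δ ∧ ∀ᶠ X : ℕ in atTop,
      δ * ((all.below X).card : ℝ) ≤ ((Φ.below X).card : ℝ))
    (hP : all.HasDensityOn P 1) : Φ.HasDensityOn P 1 := by
  classical
  obtain ⟨δ, hδ, hev⟩ := hrel
  unfold CongruenceFamily₂.HasDensityOn at hP ⊢
  -- the lower bound `1 - (1 - prop_all(P)) / δ → 1`
  have hlow : Tendsto (fun X : ℕ ↦ 1 - (1 - all.proportionOn P X) / δ) atTop (𝓝 1) := by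
    have h := ((tendsto_const_nhds (x := (1 : ℝ))).sub hP).div_const δ
    have h' := (tendsto_const_nhds (x := (1 : ℝ))).sub h
    simpa using h'
  have hpos : ∀ᶠ X : ℕ in atTop, (1 : ℝ) / 2 < all.proportionOn P X :=
    hP.eventually (Ioi_mem_nhds (by norm_num))
  refine tendsto_of_tendsto_of_tendsto_of_le_of_le' hlow tendsto_const_nhds ?_
    (Eventually.of_forall fun X ↦ Φ.proportionOn_le_one P X)
  filter_upwards [hev, hpos] with X hX hpX
  -- names: `A = all.below X ⊇ B = Φ.below X`
  have hA : (0 : ℝ) < (all.below X).card := by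
    by_contra h0
    have h0' : ((all.below X).card : ℝ) = 0 := le_antisymm (not_lt.mp h0) (Nat.cast_nonneg _)
    rw [all.proportionOn_eq_card_filter_div, h0', div_zero] at hpX
    linarith
  have hB : (0 : ℝ) < (Φ.below X).card := lt_of_lt_of_le (mul_pos hδ hA) hX
  rw [all.proportionOn_eq_card_filter_div, Φ.proportionOn_eq_card_filter_div]
  -- the exceptions of `Φ` are among the exceptions of `all`
  have hsplitB := Finset.card_filter_add_card_filter_not (s := Φ.below X) P
  have hsplitA := Finset.card_filter_add_card_filter_not (s := all.below X) P
  have hmono : ((Φ.below X).filter fun a ↦ ¬ P a).card ≤ ((all.below X).filter fun a ↦ ¬ P a).card :=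
    Finset.card_le_card (Finset.filter_subset_filter _ (Φ.below_subset_all_below X))
  set BP : ℝ := (((Φ.below X).filter P).card : ℝ) with hBP
  set AP : ℝ := (((all.below X).filter P).card : ℝ) with hAP
  set B : ℝ := ((Φ.below X).card : ℝ) with hBdef
  set A : ℝ := ((all.below X).card : ℝ) with hAdef
  have e1 : BP = B - (((Φ.below X).filter fun a ↦ ¬ P a).card : ℝ) := by
    rw [hBP, hBdef, ← hsplitB]; push_cast; ring
  have e2 : (((all.below X).filter fun a ↦ ¬ P a).card : ℝ) = A - AP := by
    rw [hAP, hAdef, ← hsplitA]; push_cast; ring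
  have hmonoR : (((Φ.below X).filter fun a ↦ ¬ P a).card : ℝ) ≤
      (((all.below X).filter fun a ↦ ¬ P a).card : ℝ) := by exact_mod_cast hmono
  -- `D = A - AP ≥ 0` exceptions in `all`; `BP ≥ B - D`
  have hD : 0 ≤ A - AP := by rw [← e2]; exact Nat.cast_nonneg _
  have hBPge : B - (A - AP) ≤ BP := by rw [e1, ← e2]; linarith
  have hδA : 0 < δ * A := mul_pos hδ hA
  calc 1 - (1 - AP / A) / δ = 1 - (A - AP) / (δ * A) := by
        field_simp
    _ ≤ 1 - (A - AP) / B := by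
        have : (A - AP) / B ≤ (A - AP) / (δ * A) := div_le_div_of_nonneg_left hD hδA hX
        linarith
    _ = (B - (A - AP)) / B := by
        field_simp
    _ ≤ BP / B := div_le_div_of_nonneg_right hBPge hB.le

end CongruenceFamily₂

/-! ### Corollaries of Theorem 9.1 -/

namespace thm9_1_F2

/-- **A large subfamily with nonempty local conditions has positive lower relative density in `F₂`**
(modulo `thm9_1_F2`): there is `δ > 0` with `δ · #(all.below X) ≤ #(Φ.below X)` for all large `X`
(the ratio of the two counting functions tends to `c_Φ / c_{F₂} > 0`).
[cite: BhargavaHo2022, Thm. 9.1 (§9.1, p. 31)] -/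
theorem relative (h : thm9_1_F2) (Φ : CongruenceFamily₂) (hΦ : Φ.IsLarge)
    (hne : ∀ p : ℕ, p.Prime → (Φ.residues p).Nonempty) :
    ∃ δ : ℝ, 0 < δ ∧ ∀ᶠ X : ℕ in atTop,
      δ * ((CongruenceFamily₂.all.below X).card : ℝ) ≤ ((Φ.below X).card : ℝ) := by
  obtain ⟨c, hc, hΦc⟩ := h Φ hΦ hne
  obtain ⟨c', hc', hallc⟩ := h CongruenceFamily₂.all CongruenceFamily₂.isLarge_all
    fun p _ ↦ CongruenceFamily₂.residues_all_nonempty p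
  refine ⟨c / (4 * c'), by positivity, ?_⟩
  -- eventually `#Φ.below X ≥ (c/2) X^{2/3}` and `#all.below X ≤ 2c' X^{2/3}`
  have h1 : ∀ᶠ X : ℕ in atTop, c / 2 < ((Φ.below X).card : ℝ) / (X : ℝ) ^ ((2 : ℝ) / 3) :=
    hΦc.eventually (Ioi_mem_nhds (by linarith))
  have h2 : ∀ᶠ X : ℕ in atTop,
      ((CongruenceFamily₂.all.below X).card : ℝ) / (X : ℝ) ^ ((2 : ℝ) / 3) < 2 * c' :=
    hallc.eventually (Iio_mem_nhds (by linarith))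
  have h3 : ∀ᶠ X : ℕ in atTop, 1 ≤ X := eventually_ge_atTop 1
  filter_upwards [h1, h2, h3] with X hX1 hX2 hX3
  have hXpos : (0 : ℝ) < (X : ℝ) ^ ((2 : ℝ) / 3) :=
    Real.rpow_pos_of_pos (by exact_mod_cast hX3) _
  rw [lt_div_iff₀ hXpos] at hX1
  rw [div_lt_iff₀ hXpos] at hX2
  -- `c/(4c') · #all < c/(4c') · 2c' X^{2/3} = (c/2) X^{2/3} < #Φ`
  have hcc : c / (4 * c') * (2 * c' * (X : ℝ) ^ ((2 : ℝ) / 3)) = c / 2 * (X : ℝ) ^ ((2 : ℝ) / 3) := by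
    field_simp
    ring
  have hstep : c / (4 * c') * ((CongruenceFamily₂.all.below X).card : ℝ) ≤
      c / (4 * c') * (2 * c' * (X : ℝ) ^ ((2 : ℝ) / 3)) :=
    mul_le_mul_of_nonneg_left hX2.le (by positivity)
  linarith

/-- **A 100 % property of `F₂` is a 100 % property of every large subfamily with nonempty local
conditions** (modulo `thm9_1_F2`). [cite: BhargavaHo2022, Thm. 9.1 (§9.1, p. 31)] -/
theorem hasDensityOn_one_of_all (h : thm9_1_F2) (Φ : CongruenceFamily₂) (hΦ : Φ.IsLarge)
    (hne : ∀ p : ℕ, p.Prime → (Φ.residues p).Nonempty) {P : Params → Prop}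
    (hP : CongruenceFamily₂.all.HasDensityOn P 1) : Φ.HasDensityOn P 1 :=
  Φ.hasDensityOn_one_of_relative (relative h Φ hΦ hne) hP

/-- **Generic members of a large subfamily** (modulo the two Bhargava–Ho facts `thm9_1_F2` and
`thm10_1_F2`): in every large subfamily of `F₂` with nonempty local conditions, 100 % of the members
ordered by height have trivial rational torsion and rank `E(ℚ) ≥ 2` — Thm. 10.1 (printed for the whole
of `F₂`) transported along Thm. 9.1. This is the printed content of the support item
`GenericMembersLargeF2` of `route-BirchSwinnertonDyer-CountingDoorF2AtThree` without its
`ρ̄₃`-irreducibility clause. [cite: BhargavaHo2022, Thm. 10.1 (§10, p. 35) and Thm. 9.1 (§9.1, p. 31)] -/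
theorem hasDensityOn_torsionOrder_rank_of_isLarge (h9 : thm9_1_F2) (h10 : thm10_1_F2)
    (Φ : CongruenceFamily₂) (hΦ : Φ.IsLarge) (hne : ∀ p : ℕ, p.Prime → (Φ.residues p).Nonempty) :
    Φ.HasDensityOn (fun a ↦ a.curve.torsionOrder = 1 ∧ 2 ≤ a.curve.mordellWeilRank) 1 :=
  hasDensityOn_one_of_all h9 Φ hΦ hne h10.hasDensityOn_and

end thm9_1_F2

end Literature.NumberTheory.EllipticCurves.BhargavaHo2022
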